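import Summits.QuantumFields.YangMills.Theorems.UnitScaleTiltProp7CovariantLocalMinimality
import Literature.MathematicalPhysics.QuantumFieldTheory.Balaban1983to89.T3PrintedRegularMinimiser
import HarnessLib

/-!
# Route `UnitScaleTilt`, crux K1 child «MinimiserStabilityRegPr» (stmt-QuantumFields-19200), registered stub `stub_prop7From14` (v4 828f5fb4a904d3be;
# V3 = `T3Thm1CarrierNative.Prop7From14At`) — the NON-FLAT local-minimality model READ IN THE CARRIER's VOCABULARY: background `U₀` in print's regular space (6)∕(14)
# `𝔘_k(ε)` (`T3PrintedRegularMinimiser.RegPr F n K ε U₀`), competitor with fluctuation `Y = UU₀^* − 1` within `ε₂L^{−(K−n)}` of `0` bondwise (print's chart radius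
# (19)) on the covariant slice: `((1/288) − 96ε − 24ε² − 1536ε₂²)·L^{−2(K−n)}·Σ_b‖Y(b)‖² ≤ A(U) − A(U₀) − Lin_{U₀}(U)` — the admissible `ε`, `ε₂` are ABSOLUTE

Cell `ym3-torus` ∕ fleet seat `ym-ust-19200-p1` (HUMAN RULING D-0037, YM ladder rung R3), successor g2.  A corollary of `UnitScaleTiltProp7CovariantLocalMinimality`
(`Prop7CovariantCoercivity.wilsonAction4_sub_background_ge_T3`) with the radii read off the route's carrier, exactly as the flat twin
`UnitScaleTiltProp7FlatLocalMinimalityRegPr` (p459739) reads `UnitScaleTiltProp7FlatLocalMinimality`: the background's plaquette radius is print's (6)∕(14)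
`|U₀(∂p) − 1| < εL^{−2(K−n)}` (`RegPr`, plaquette clause `PlaqSmall (regThreshold F n K ε)`), the fluctuation radius is print's (19) `|ηA| < ε₂L^{−k}`.  Substituting
`a = εL^{−2(K−n)}`, `δ = ε₂L^{−(K−n)}` and using `L^{−4(K−n)} ≤ L^{−2(K−n)}`: the rate `(1/288)L^{−2(K−n)} − 12(2a² + 128δ² + 8a)` is at least
`((1/288) − 96ε − 24ε² − 1536ε₂²)·L^{−2(K−n)}` — POSITIVE for, e.g., `ε ≤ 10⁻⁵`, `ε₂ ≤ 10⁻³`, thresholds depending on nothing (print's «absolute constants a₀, a′₁», p. 299).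

WHAT IS PROVED (sorry-free, no definition): **`wilsonAction4_sub_background_ge_of_regPr_T3`** (the displayed bound).  MODEL caveats as in the parent file (covariant
slice = linearised constraint and gauge at `U₀`, not the (0.4)-fibre with print's gauge; `Lin_{U₀}(U)` is the exact first variation, vanishing only at a critical
background).  Nothing of Bałaban's is asserted.

References: T. Bałaban, CMP 102 (1985) 277–309 [Balaban1985Variational] ((2)/(6) p.278, (14) p.280, (19) p.281, Prop. 7 and (141)–(143) p.299).
-/

noncomputable section

open scoped BigOperators Matrix.Norms.L2Operator Matrix

namespace Summit.QuantumFields.YangMills.Theorems.Prop7CovariantCoercivity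

open Literature.MathematicalPhysics.QuantumFieldTheory.Balaban1983to89
open Finset B1RG242Torus
open T3ContinuumYM3Torus T3RegularMinimiser T3PrintedRegularMinimiser
open B7Prop1Explicit (treeWord)
open B7Eq78Linearization (conjR)
open B9Eq39Adjoint (divB)
open B10Eq27TorusAxialLog (holT unitsField toUField)
open B9TorusCalculus (torusT)

/-- **THE NON-FLAT LOCAL-MINIMALITY MODEL FOR A BACKGROUND OF PRINT'S REGULAR SPACE `𝔘_k(ε)`** (`RegPr F n K ε U₀`; plaquette clause used) and a competitor whose
fluctuation `Y(b) = U(b)U₀(b)^* − 1` is within `ε₂L^{−(K−n)}` of `0` and lies on the covariant slice (`D^*_{U₀}Y = 0`, vanishing covariant straight-line block averages):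
`((1/288) − 96ε − 24ε² − 1536ε₂²)·L^{−2(K−n)}·Σ_b‖Y(b)‖² ≤ A(U) − A(U₀) − Lin_{U₀}(U)`, uniformly in `m`, `n`, `K`.
[cite: Balaban1985Variational, (141)-(143) p.299, (6) p.278, (19) p.281] -/
theorem wilsonAction4_sub_background_ge_of_regPr_T3 (F : T3Family) (n K : ℕ) {ε ε₂ : ℝ} (hε : 0 ≤ ε) (hε1 : 216 * ε ≤ 1)
    (U U₀ : GaugeField (F.P K) 0 (Matrix.specialUnitaryGroup (Fin 2) ℂ)) (hreg : RegPr F n K ε U₀)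
    (hδ : ∀ b : PBond (F.P K) 0, ‖(U b : Matrix (Fin 2) (Fin 2) ℂ) * star (U₀ b : Matrix (Fin 2) (Fin 2) ℂ) - 1‖ ≤ ε₂ * ((F.L : ℝ)⁻¹) ^ (K - n))
    (hδ1 : ε₂ * ((F.L : ℝ)⁻¹) ^ (K - n) ≤ 1)
    (hdiv : ∀ x : Site (F.P K) 0, divB (torusT (F.P K) 0) (fun κ z => unitsField (toUField U₀) ⟨z, κ⟩)
      (fun κ z => (U ⟨z, κ⟩ : Matrix (Fin 2) (Fin 2) ℂ) * star (U₀ ⟨z, κ⟩ : Matrix (Fin 2) (Fin 2) ℂ) - 1) x = 0)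
    (havg : ∀ c : PBond (F.P K) (K - n), ∑ r : Fin (F.P K).d → Fin ((F.P K).L ^ (K - n)), ∑ t ∈ range ((F.P K).L ^ (K - n)),
        conjR (holT (unitsField (toUField U₀)) (Site.fibreSite 0 (K - n) c.src fun _ => ⟨0, pow_pos (F.P K).L_pos (K - n)⟩)
              (treeWord fun ν => ((r ν : ℕ) : ℤ))
            * holT (unitsField (toUField U₀)) (Site.fibreSite 0 (K - n) c.src r) (List.replicate t (c.dir, true)))
          ((U ⟨(fun z : Site (F.P K) 0 => z.shift c.dir)^[t] (Site.fibreSite 0 (K - n) c.src r), c.dir⟩ : Matrix (Fin 2) (Fin 2) ℂ)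
              * star (U₀ ⟨(fun z : Site (F.P K) 0 => z.shift c.dir)^[t] (Site.fibreSite 0 (K - n) c.src r), c.dir⟩ : Matrix (Fin 2) (Fin 2) ℂ) - 1) = 0) :
    (((1 / 288) - 96 * ε - 24 * ε ^ 2 - 1536 * ε₂ ^ 2) * (((F.L : ℝ) ^ (K - n)) ^ 2)⁻¹)
        * ∑ b : PBond (F.P K) 0, ‖(U b : Matrix (Fin 2) (Fin 2) ℂ) * star (U₀ b : Matrix (Fin 2) (Fin 2) ℂ) - 1‖ ^ 2
      ≤ wilsonAction4 U - wilsonAction4 U₀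
        - ∑ p : Plaq (F.P K) 0, (1 / 2) * ((((((GaugeField.plaqHol U₀ p : Matrix.specialUnitaryGroup (Fin 2) ℂ) : Matrix (Fin 2) (Fin 2) ℂ)) - 1)ᴴ
          * ((((U ⟨p.src, p.μ⟩ : Matrix (Fin 2) (Fin 2) ℂ) * star (U₀ ⟨p.src, p.μ⟩ : Matrix (Fin 2) (Fin 2) ℂ) - 1)
              + (U₀ ⟨p.src, p.μ⟩ : Matrix (Fin 2) (Fin 2) ℂ)
                  * ((U ⟨p.src.shift p.μ, p.ν⟩ : Matrix (Fin 2) (Fin 2) ℂ) * star (U₀ ⟨p.src.shift p.μ, p.ν⟩ : Matrix (Fin 2) (Fin 2) ℂ) - 1)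
                  * star (U₀ ⟨p.src, p.μ⟩ : Matrix (Fin 2) (Fin 2) ℂ)
              - ((U₀ ⟨p.src, p.μ⟩ * U₀ ⟨p.src.shift p.μ, p.ν⟩ * (U₀ ⟨p.src.shift p.ν, p.μ⟩)⁻¹ : Matrix.specialUnitaryGroup (Fin 2) ℂ) : Matrix (Fin 2) (Fin 2) ℂ)
                  * ((U ⟨p.src.shift p.ν, p.μ⟩ : Matrix (Fin 2) (Fin 2) ℂ) * star (U₀ ⟨p.src.shift p.ν, p.μ⟩ : Matrix (Fin 2) (Fin 2) ℂ) - 1)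
                  * star ((U₀ ⟨p.src, p.μ⟩ * U₀ ⟨p.src.shift p.μ, p.ν⟩ * (U₀ ⟨p.src.shift p.ν, p.μ⟩)⁻¹ : Matrix.specialUnitaryGroup (Fin 2) ℂ) : Matrix (Fin 2) (Fin 2) ℂ)
              - ((GaugeField.plaqHol U₀ p : Matrix.specialUnitaryGroup (Fin 2) ℂ) : Matrix (Fin 2) (Fin 2) ℂ)
                  * ((U ⟨p.src, p.ν⟩ : Matrix (Fin 2) (Fin 2) ℂ) * star (U₀ ⟨p.src, p.ν⟩ : Matrix (Fin 2) (Fin 2) ℂ) - 1)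
                  * star ((GaugeField.plaqHol U₀ p : Matrix.specialUnitaryGroup (Fin 2) ℂ) : Matrix (Fin 2) (Fin 2) ℂ))
            * ((GaugeField.plaqHol U₀ p : Matrix.specialUnitaryGroup (Fin 2) ℂ) : Matrix (Fin 2) (Fin 2) ℂ))).trace).re := by
  have hL1 : (1 : ℝ) ≤ (F.L : ℝ) := by have := F.hL.2; exact_mod_cast (by omega : 1 ≤ F.L)
  have hL : (0 : ℝ) < (F.L : ℝ) := by linarith
  have hw : (0 : ℝ) < ((F.L : ℝ) ^ (K - n)) ^ 2 := by positivity
  -- the plaquette radius of the background from `RegPr`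
  have e1 : ((F.L : ℝ)⁻¹) ^ (2 * (K - n)) = (((F.L : ℝ) ^ (K - n)) ^ 2)⁻¹ := by
    rw [inv_pow, ← pow_mul, mul_comm]
  have hU₀ : ∀ p : Plaq (F.P K) 0, dist1 (GaugeField.plaqHol U₀ p) ≤ ε * (((F.L : ℝ) ^ (K - n)) ^ 2)⁻¹ := by
    intro p
    have h := (hreg.plaqSmall p).le
    rwa [regThreshold, e1] at h
  -- the main inequality with `a = εL^{-2(K-n)}`, `δ = ε₂L^{-(K-n)}`
  have hmain := wilsonAction4_sub_background_ge_T3 F n K U U₀ hε hε1 hU₀ hδ hδ1 hdiv havg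
  -- compare the rates: `w = L^{-2(K-n)} ≤ 1`
  set w : ℝ := (((F.L : ℝ) ^ (K - n)) ^ 2)⁻¹ with hw_def
  have hw0 : 0 < w := inv_pos.mpr hw
  have hw1 : w ≤ 1 := by
    rw [hw_def]
    have : (1 : ℝ) ≤ ((F.L : ℝ) ^ (K - n)) ^ 2 := one_le_pow₀ (one_le_pow₀ hL1)
    exact inv_le_one_of_one_le₀ this
  have e2 : (ε₂ * ((F.L : ℝ)⁻¹) ^ (K - n)) ^ 2 = ε₂ ^ 2 * w := by
    rw [hw_def, mul_pow, inv_pow, inv_pow]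
  rw [e2] at hmain
  have hrate : ((1 / 288) - 96 * ε - 24 * ε ^ 2 - 1536 * ε₂ ^ 2) * w
      ≤ (1 / 288) * w - 12 * (2 * (ε * w) ^ 2 + 128 * (ε₂ ^ 2 * w) + 8 * (ε * w)) := by
    have h1 : (ε * w) ^ 2 ≤ ε ^ 2 * w := by
      rw [mul_pow]
      have : w ^ 2 ≤ w := by nlinarith
      exact mul_le_mul_of_nonneg_left this (sq_nonneg ε)
    nlinarith [h1, hw0, sq_nonneg ε₂, hε]
  have hS0 : 0 ≤ ∑ b : PBond (F.P K) 0, ‖(U b : Matrix (Fin 2) (Fin 2) ℂ) * star (U₀ b : Matrix (Fin 2) (Fin 2) ℂ) - 1‖ ^ 2 :=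
    Finset.sum_nonneg fun _ _ => sq_nonneg _
  exact (mul_le_mul_of_nonneg_right hrate hS0).trans hmain

end Summit.QuantumFields.YangMills.Theorems.Prop7CovariantCoercivity

end
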